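import Mathlib.RingTheory.MvPolynomial.WeightedHomogeneous
import Mathlib.Data.List.Lex
import Literature.Barriers.ValiantsHypothesis.CKRST20NaturalProofsExist
import Literature.Computability.Complexity.Classes
import Literature.Computability.Complexity.BoolEncodings
import HarnessLib

/-!
# Guo–Kumar–Saptharishi–Solomon 2019/2022: hitting-set generators from constant-variate algebraic
# hardness — the generator `G_P = (Δ_0(P), …, Δ_n(P))`, the main theorem, derandomization of PIT from
# `k`-variate lower bounds, bootstrapping of hitting sets, Question 1.4

Typed literature (cell `val-lit`, cross-ladder typing seat x6; D-0064 one file per source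
section-group; this file = §1 (Def 1, Question 4, Thm 5 and the bootstrapping theorem), §1.3 Def 9
and the main theorem, §2.2 Thm 15 (Heintz–Schnorr/Agrawal) and §3.2 Thm 25 of the source).
HONEST FRAMING: cite-tagged statements of published results; typed ≠ proved ≠ endorsed;
`VP ≠ VNP` is NOT proved and nothing here is progress on it (LADDER-VALIANT V4: hardness-to-hitting-
sets bootstrapping, the regime next to FSV's succinct hitting sets and KI-generators; ideation, not
load-bearing for the GAP rows).

Source: Z. Guo, M. Kumar, R. Saptharishi, N. Solomon, *Derandomization from algebraic hardness*,
SIAM J. Comput. 51(2) (2022) 315–335 (FOCS 2019) = arXiv:1905.00091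
[GuoKumarSaptharishiSolomon2019]. NUMBERING. The held corpus-tex rendering
`paper:arxiv-1905.00091` (17 chunks `pNNNN.txt`, the 4-author journal version) numbers its
environments SEQUENTIALLY and leaves the `restatable` theorems UNNUMBERED; its numbers are the ones
the cell's reading list uses: ‹Definition 1› (HSG), ‹Question 4›, ‹Theorem 5› (main theorem, simple
form), the unnumbered ‹Bootstrapping hitting sets› theorem (p0005.txt:L44–p0006.txt:L2), ‹Definition 9›
(the generator), the unnumbered main theorem ‹G_P is an HSG› (p0006.txt:L52-57), ‹Theorem 15›
([HS80]/[A05]), ‹Theorem 25› (general form). The same statements in ECCC TR19-065 revision 2 (the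
4-author "borderless version", held as `paper:url-fe6f878b7e74`, PDF pages) are numbered Question 1.4
(p.4), Definition 1.5 (p.5), Theorem 1.6 (Main theorem, p.5), Theorem 1.7 (Bootstrapping, p.6; there
with "`k` large enough" and size `s^{O((k/δ)²)}`), Theorem 2.3 (p.10), Theorem 3.3 (p.16, "`k` large
enough"); the journal/arXiv version strengthens 1.7/3.3 to arbitrary constant `k` resp. `k(d) =
o(√log d)` — we type the held (journal) wording and give both locators. Decl names use the held
numbers (`_thm_5`, `_question_4`, `_thm_15`, `_thm_25`) and content names for the unnumbered ones
(`_mainThm`, `_bootstrapping`). ECCC revision 0/1 (3 authors, "Treading the borders") is a DIFFERENT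
paper (border-complexity hypotheses) and is not typed here.

## Setting and rendering (read by referees)

* GKSS's `𝒞(n, d, s)` = `n`-variate polynomials of degree `≤ d` computable by size-`s` circuits
  (§2.1 Def 11: size = number of gates, field constants on edges free) is the tree's CKRST slice
  `vpSlice F n d s = {f | deg f ≤ d ∧ complexity f ≤ s}` (CITED, `CKRST20NaturalProofsExist.lean`),
  whose `complexity` is the fan-in-two gate count with free constants (`ArithCircuit.lean`). MODEL
  NOTE: the two size measures agree up to polynomial (at worst quadratic) distortion; every typed
  statement below either quantifies over an arbitrary exponent `δ > 0` / concludes `poly(s)` (so it is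
  invariant under such distortion for large parameters; the journal version's footnote to Thm 25 —
  "it suffices to assume that the family is sufficiently often" — covers the finitely many small
  degrees), or (the main theorem) is typed with a polynomially STRONGER hardness hypothesis
  `(s·D·d³·n^{10k} + 2)^c < complexity P` for an absolute `c` (WEAKER than print, which has `c = 1`
  in the gate-count model), so that it is implied by the printed statement under any polynomial
  model translation. `𝒞(k, i-deg: d, s)` (individual degree) is `GKSS2019.idegSlice`.
* The generator (‹Def 9› = ECCC Def 1.5): `Δ_i(P)(z, y)` = "the homogeneous degree `i` (in `y`)
  component in the Taylor expansion of `P(z + y)`" — typed LITERALLY as the weight-`i` component of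
  `P(z + y) ∈ F[z ⊔ y]` for the weight `0` on `z`, `1` on `y` (Mathlib `weightedHomogeneousComponent`);
  the displayed formula `Σ_{|e| = i} (y^e/e!) ∂_{z^e} P` is its characteristic-`0` expansion and is
  not restated. `G_P : F^k × F^k → F^{n+1}`, `(z, y) ↦ (Δ_0(P), …, Δ_n(P))` is `GKSS2019.gen P n`
  (variables `Fin k ⊕ Fin k`, `inl` = `z`, `inr` = `y`); "`C ∘ G_P`" is `MvPolynomial.bind₁ (gen P n) C`.
* Hitting sets / generators for a class (‹Def 1›): `HittingSets.IsHittingSetFor`,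
  `HittingSets.IsGeneratorFor` (new generic predicates in the namespace of the tree's
  `HittingSets.exists_hittingSet`; the tree's `IsHittingSetGenerator` of
  `AlgebraicNaturalProofsGenerators.lean` is the special case of classes of polynomials in
  COEFFICIENT variables `M ⊆ (σ →₀ ℕ)` and is cited, not restated).
* EXPLICITNESS is the whole content of ‹Thm 5›, ‹Bootstrapping›, ‹Thm 25›, ‹Question 4› (non-explicit
  `poly(s)`-size hitting sets exist unconditionally, tree `HittingSets.exists_hittingSet`). It is
  typed in the tree's Boolean model (`FP`, `FTIME`, Mathlib `unaryEncodeNat`) over the field `ℚ`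
  (WEAKER than "any field of characteristic zero": the explicit objects have rational descriptions):
  a family `{P_d}` is explicit iff a polynomial-time machine maps `1^d` to the dense list of
  monomials of `P_d` (the paper's footnote to Question 4: "deterministic `poly(d)`-time algorithm that,
  on input `1^d`, outputs `P_d` as a sum of monomials"); a family of hitting sets `{H_s}` is explicit
  iff a polynomial-time machine maps `1^s` to the list of points of `H_s` (coordinates as
  numerator/denominator pairs) — the reading under which "explicit hitting sets of polynomial size"
  yields "PIT ∈ P" (§1: "As long as the hitting set produced is efficiently enumerable by a Turing
  machine, this is sufficient to solve the Boolean task of PIT").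
* "`P` requires circuits of size `≥ t`" = `t ≤ complexity P` (real-valued thresholds `d^δ` compared
  in `ℝ`); in ‹Thm 5›, ‹Thm 25›, ‹Question 4› the hardness of the family is required for all
  SUFFICIENTLY LARGE `d` (an asymptotic hypothesis, as the footnote to ‹Thm 25› allows: "it suffices
  to assume that the family is sufficiently often"), which also keeps the hypotheses clear of the
  small-`d` artefacts of circuit-size conventions.
* FACT-LIST marks: `-- FACT` (published, unproved here; `def … : Prop`, never asserted), `-- OPEN
  QUESTION` (printed as open; neutral, never asserted), `-- PROVED` (definitions, small API).
  No `instance`, no `notation`.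

NOT typed: ‹Thm 2›/‹Question 3› (quoted from [KST19]); Defs 6–8 and the `τ`-conjecture corollary
(the strengthened `τ`-conjecture is a CONJECTURE — not Literature; its corollary would be a
conditional); §2.3–§3.1 (homogenisation lemmas 19–20, Observations 21–22, Claim 23, Lemma 24 — proof
internals); the randomised/`∃BPP` remarks.

## v2 (2026-08-26, erratum A34)

`GKSS2019_mainThm` now binds `0 < n → 0 < D → 0 < s →` (the printed `ℕ = {1, 2, 3, …}`
convention, arXiv p0009.txt:L5); the v1 text without them was refutable at `s = 0` (cell evidence
`t19g5-GKSS19MainThm-s0-counterexample.lean`, sha16 `b20f10f8e6c9fcfa`; lead-np RULING (45)). Every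
other declaration is byte-identical to v1.

## References
* [GuoKumarSaptharishiSolomon2019] arXiv:1905.00091 = SIAM J. Comput. 51 (2022): ‹Def 1›
  (p0003.txt:L20-27), ‹Question 4› (p0005.txt:L1-5), ‹Thm 5› (p0005.txt:L28-31), ‹Bootstrapping›
  (p0005.txt:L44–p0006.txt:L2), ‹Def 9› (p0006.txt:L39-48), main theorem (p0006.txt:L52-57), ‹Def 11›
  (p0009.txt:L19-22), ‹Thm 15› (p0009.txt:L47-48), ‹Thm 25› (p0013.txt:L4-8); ECCC TR19-065 rev. 2:
  Question 1.4 (p.4), Def 1.5, Thm 1.6 (p.5), Thm 1.7 (p.6), Thm 2.3 (p.10), Thm 3.3 (p.16).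
* [ChatterjeeKumarRamyaSaptharishiTengse2020] Def. 2.2 (the slice `𝒞(n,d,s)`; tree `vpSlice`).
* [HeintzSchnorr1980] Thm. 4.4; M. Agrawal, *Proving lower bounds via pseudo-random generators*,
  FSTTCS 2005 (‹Thm 15›'s sources).
-/

noncomputable section

open MvPolynomial _root_.Computability

namespace Literature.Computability.AlgebraicComplexity

/-! ### ‹Def 1›: hitting sets, generators for a class (generic predicates) -/

namespace HittingSets

variable {F : Type*} [CommSemiring F] {n : ℕ} {τ : Type*}

-- PROVED (definition)
/-- **Hitting set for a class** `𝒞 ⊆ F[x_1..x_n]`: every nonzero member is nonzero at some point of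
`H`. (GKSS §1: "a set of points … for any nonzero polynomial … there is `v ∈ H` with `f(v) ≠ 0`";
Medini–Shpilka Def 1.7.) [cite: GuoKumarSaptharishiSolomon2019, §1 (‹Def 1› context, arXiv p0003.txt:L20-27)] -/
def IsHittingSetFor (H : Set (Fin n → F)) (𝒞 : Set (MvPolynomial (Fin n) F)) : Prop :=
  ∀ f ∈ 𝒞, f ≠ 0 → ∃ a ∈ H, eval a f ≠ 0

-- PROVED (definition)
/-- **Hitting-set generator for a class** (‹Def 1› = ECCC Def 1.1): "A polynomial map
`G : F^k → F^n`, `G(z) = (g_1(z), …, g_n(z))` is said to be a hitting-set generator (HSG) for a class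
`𝒞 ⊆ F[x_1..x_n]` of polynomials if for every nonzero `Q ∈ 𝒞`, we have that
`Q ∘ G = Q(g_1, …, g_n)` is also nonzero." (`Q ∘ G = bind₁ G Q`; seed variables `τ`.)
[cite: GuoKumarSaptharishiSolomon2019, Def 1 (arXiv p0003.txt:L20-22; = ECCC TR19-065r2 Def 1.1)] -/
def IsGeneratorFor (G : Fin n → MvPolynomial τ F) (𝒞 : Set (MvPolynomial (Fin n) F)) : Prop :=
  ∀ Q ∈ 𝒞, Q ≠ 0 → bind₁ G Q ≠ 0

-- PROVED (definition)
/-- A LIST of points (coordinates as lists, missing coordinates read as `0`) hits a class — the form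
in which explicit (machine-output) hitting sets are consumed below.
[cite: GuoKumarSaptharishiSolomon2019, §1 (arXiv p0003.txt:L38 "efficiently enumerable by a Turing machine")] -/
def ListHits (H : List (List F)) (𝒞 : Set (MvPolynomial (Fin n) F)) : Prop :=
  ∀ f ∈ 𝒞, f ≠ 0 → ∃ a ∈ H, eval (fun i : Fin n => a.getD i.val 0) f ≠ 0

end HittingSets

namespace GKSS2019

/-! ### ‹Def 11›: the slices `𝒞(n, d, s)` (tree `vpSlice`) and `𝒞(n, i-deg: d, s)` -/

section Slices

variable (F : Type*) [Field F]

-- PROVED (definition)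
/-- **`𝒞(n, i-deg: d, t)`**: `n`-variate polynomials of INDIVIDUAL degree `≤ d` ("maximum degree of
any variable") computable by circuits of size `≤ t` — here with a REAL size threshold `t` (so that
`s^δ` can be used verbatim); size = tree `complexity` (see the module's MODEL NOTE). The total-degree
slice `𝒞(n, d, s)` is the tree's `vpSlice F n d s`.
[cite: GuoKumarSaptharishiSolomon2019, Def 11 and §1.1 (arXiv p0009.txt:L19-24, p0004.txt:L5-6; = ECCC TR19-065r2 §2.1)] -/
def idegSlice (n d : ℕ) (t : ℝ) : Set (MvPolynomial (Fin n) F) :=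
  {f | (∀ i, degreeOf i f ≤ d) ∧ (complexity f : ℝ) ≤ t}

end Slices

/-! ### ‹Def 9› (ECCC Def 1.5): the generator `G_P` -/

section Generator

variable {F : Type*} [CommRing F] {k : ℕ}

-- PROVED (definition)
/-- `P(z + y) ∈ F[z ⊔ y]` (`inl` = `z`, `inr` = `y`). [cite: GuoKumarSaptharishiSolomon2019, Def 9 (arXiv p0006.txt:L39-48; = ECCC TR19-065r2 Def 1.5)] -/
def shifted (P : MvPolynomial (Fin k) F) : MvPolynomial (Fin k ⊕ Fin k) F :=
  aeval (fun j : Fin k => (X (Sum.inl j) + X (Sum.inr j) : MvPolynomial (Fin k ⊕ Fin k) F)) P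

-- PROVED (definition)
/-- The `y`-degree weight on `F[z ⊔ y]`: `0` on `z`, `1` on `y`. [cite: GuoKumarSaptharishiSolomon2019, Def 9 (arXiv p0006.txt:L39-48)] -/
def yWeight (k : ℕ) : Fin k ⊕ Fin k → ℕ :=
  Sum.elim (fun _ => 0) (fun _ => 1)

-- PROVED (definition)
/-- **`Δ_i(P)(z, y)`** = "the homogeneous degree `i` (in `y`) component in the Taylor expansion of
`P(z + y)`, i.e. `Δ_i(P)(z,y) = Σ_{e ∈ ℕ^k, |e| = i} (y^e/e!) · ∂P/∂z^e`" — typed as the `y`-weight-`i`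
component of `P(z + y)` (the displayed Taylor formula is its characteristic-`0` expansion).
[cite: GuoKumarSaptharishiSolomon2019, Def 9 (arXiv p0006.txt:L39-48; = ECCC TR19-065r2 Def 1.5, p.5)] -/
def delta (P : MvPolynomial (Fin k) F) (i : ℕ) : MvPolynomial (Fin k ⊕ Fin k) F :=
  weightedHomogeneousComponent (yWeight k) i (shifted P)

-- PROVED (definition)
/-- **The generator `G_P : F^k × F^k → F^{n+1}`**, "`G_P(z, y) = (Δ_0(P)(z,y), Δ_1(P)(z,y), …,
Δ_n(P)(z,y))`" — one polynomial in the `2k` seed variables per coordinate `i ≤ n`.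
[cite: GuoKumarSaptharishiSolomon2019, Def 9 (arXiv p0006.txt:L39-43; = ECCC TR19-065r2 Def 1.5, p.5)] -/
def gen (P : MvPolynomial (Fin k) F) (n : ℕ) : Fin (n + 1) → MvPolynomial (Fin k ⊕ Fin k) F :=
  fun i => delta P i

end Generator

/-! ### Explicitness (Boolean model, over `ℚ`) -/

section Explicit

open Literature.Computability.Complexity

-- PROVED (definition)
/-- The dense list of monomials of `P ∈ ℚ[z_1..z_k]` ("`P_d` as a sum of monomials"): the support,
as exponent lists in lexicographic order, each with its coefficient as (numerator, denominator).
[cite: GuoKumarSaptharishiSolomon2019, Question 4, footnote (arXiv p0005.txt:L2 "outputs P_d as a sum of monomials")] -/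
def denseList {k : ℕ} (P : MvPolynomial (Fin k) ℚ) : List (List ℕ × (ℤ × ℕ)) :=
  ((P.support.image fun e : Fin k →₀ ℕ => List.ofFn fun i : Fin k => e i).sort (· ≤ ·)).map
    fun l =>
      let e : Fin k →₀ ℕ := Finsupp.equivFunOnFinite.symm fun i : Fin k => l.getD i.val 0
      (l, ((coeff e P).num, (coeff e P).den))

-- PROVED (definition)
/-- Boolean encoding of dense monomial lists. [cite: GuoKumarSaptharishiSolomon2019, Question 4, footnote (arXiv p0005.txt:L2)] -/
def monomialListEncoding : Encoding (List (List ℕ × (ℤ × ℕ))) Bool :=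
  (encodingNatBool.listBool.pairBool (encodingIntBool.pairBool encodingNatBool)).listBool

-- PROVED (definition)
/-- Boolean encoding of a finite list of rational points (each point a list of coordinates, each
coordinate as (numerator, denominator)). [cite: GuoKumarSaptharishiSolomon2019, §1 (arXiv p0003.txt:L38)] -/
def encodePoints (H : List (List ℚ)) : List Bool :=
  (encodingIntBool.pairBool encodingNatBool).listBool.listBool.encode
    (H.map fun a => a.map fun q => (q.num, q.den))

-- PROVED (definition)
/-- **Explicit family (dense representation)**: "there is [a] deterministic `poly(d)`-time algorithm
that, on input `1^d`, outputs `P_d` as a sum of monomials" — a polynomial-time string function (tree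
`FP`) mapping the unary `d` to the encoded dense list of `P_d` (families of any arity profile
`k : ℕ → ℕ`). [cite: GuoKumarSaptharishiSolomon2019, Question 4, footnote (arXiv p0005.txt:L2; = ECCC TR19-065r2 Question 1.4, p.4)] -/
def IsExplicitFamily {k : ℕ → ℕ} (P : (d : ℕ) → MvPolynomial (Fin (k d)) ℚ) : Prop :=
  ∃ g ∈ FP, ∀ d, g (unaryEncodeNat d) = monomialListEncoding.encode (denseList (P d))

-- PROVED (definition)
/-- **Explicit family of point sets** `{H_s}`: a polynomial-time machine outputs, on input `1^s`, the
list of points of `H_s` ("hitting sets, that can be enumerated by a deterministic Turing machine in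
time `poly(s)`"; hence `|H_s| ≤ poly(s)` and all coordinates have `poly(s)` bits).
[cite: GuoKumarSaptharishiSolomon2019, §1.2 (arXiv p0006.txt:L28 "enumerated by a deterministic Turing machine in time poly(s)"; p0003.txt:L38)] -/
def IsExplicitPoints (H : ℕ → List (List ℚ)) : Prop :=
  ∃ g ∈ FP, ∀ s, g (unaryEncodeNat s) = encodePoints (H s)

-- PROVED (definition)
/-- Point sets computable in time `O(t(s))` on input `1^s` (tree `FTIME`), for the
`DTIME(n^{poly(k(n))})` reading of ‹Question 4›. [cite: GuoKumarSaptharishiSolomon2019, Question 4 (arXiv p0005.txt:L1-5)] -/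
def IsPointsInTime (t : ℕ → ℕ) (H : ℕ → List (List ℚ)) : Prop :=
  ∃ g ∈ FTIME t, ∀ s, g (unaryEncodeNat s) = encodePoints (H s)

end Explicit

end GKSS2019

/-! ### The main theorem (‹G_P is an HSG›; ECCC Thm 1.6) -/

section MainTheorem

open GKSS2019 HittingSets Literature.Barriers.ValiantsHypothesis

-- FACT
/-- **GKSS main theorem (‹G_P is an HSG›, restated unnumbered in the journal text; = ECCC TR19-065
rev. 2 Thm 1.6).** "Assume that the underlying field `F` has characteristic zero. Let `P` be a
`k`-variate polynomial of degree `d`, for arbitrary integers `k, d > 0`. Suppose `P` cannot be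
computed by algebraic circuits of size `s̃ = (s · D · d³ · n^{10k})` for parameters `n, D, s`. Then,
for any `(n+1)`-variate polynomial `C(x_0, …, x_n) ∈ 𝒞(n+1, D, s)`, we have
`C ≠ 0 ⟺ C ∘ G_P(z, y) ≠ 0`." Typed (see MODEL NOTE): for an absolute exponent `c`, hardness
`(s·D·d³·n^{10k} + 2)^c < complexity P` in the tree's fan-in-two measure implies that `G_P` is a
generator for `vpSlice F (n+1) D s` (the `⟸` direction of the printed `⟺` is trivial and omitted).
WEAKER than print (polynomially stronger hypothesis absorbing the circuit-size model).
ERRATUM (v2, 2026-08-26, val-lit PRINT-ERRATA registry A34, typed-side; lead-np RULING (45)): the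
parameters `n, D, s` are now required positive, as in print (GKSS §2, arXiv p0009.txt:L5: "We use
`ℕ` to denote the set of natural numbers `{1, 2, 3, …}`"). The first landed text omitted these three
binders and was REFUTABLE through the degenerate budget `s = 0`: `X_n ∈ vpSlice F (n+1) D 0` while
`Δ_n(P) = 0` as soon as `n > deg P`, and the hardness hypothesis degenerates to
`2 ^ c < complexity P` (kernel certificate `not_GKSS2019_mainThm` against the v1 text, cell
evidence file `t19g5-GKSS19MainThm-s0-counterexample.lean`, sha16 `b20f10f8e6c9fcfa`). Only
`0 < s` is needed for truth (`D = 0`: constants; `n ≤ 1`: true by the `y`-grading and the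
transcendence of a non-constant `P`); `0 < n`, `0 < D` are kept for faithfulness to the printed
convention.
[cite: GuoKumarSaptharishiSolomon2019, main theorem ‹G_P is an HSG› (arXiv p0006.txt:L52-57, recalled p0011.txt:L3; = ECCC TR19-065r2 Thm 1.6, p.5)] -/
def GKSS2019_mainThm : Prop :=
  ∃ c : ℕ, ∀ (F : Type) [Field F] [CharZero F] (k d n D s : ℕ) (P : MvPolynomial (Fin k) F),
    0 < k → 0 < d → 0 < n → 0 < D → 0 < s → P.totalDegree = d →
    (s * D * d ^ 3 * n ^ (10 * k) + 2) ^ c < complexity P →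
    IsGeneratorFor (gen P n) (vpSlice F (n + 1) D s)

end MainTheorem

/-! ### ‹Theorem 5›, ‹Bootstrapping›, ‹Theorem 25›, ‹Question 4› (explicit statements, over `ℚ`) -/

section Derandomization

open GKSS2019 HittingSets Literature.Barriers.ValiantsHypothesis Literature.Computability.Complexity
open Filter

-- FACT
/-- **GKSS ‹Thm 5› (Main theorem, simpler form of ‹Thm 25›).** "Assume that the underlying field `F`
has characteristic zero. Let `k ∈ ℕ` and `δ > 0` be arbitrary constants. Suppose `{P_{k,d}}_{d ∈ ℕ}`
is an explicit family of `k`-variate polynomials such that `deg(P_{k,d}) = d` and `P_{k,d}` requires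
circuits of size at least `d^δ`. Then, there are explicit hitting sets of size `poly_{δ,k}(s)` for
the class `𝒞(s, s, s)`." Typed over `ℚ` (explicitness in the Boolean model, see module docstring):
explicit dense family with `deg P_d = d`, hardness `d^δ ≤ complexity (P d)` for all sufficiently
large `d` (the journal text's footnote to ‹Thm 25›: "it suffices to assume that the family is
sufficiently often" — hardness is an asymptotic requirement; this also keeps the hypothesis clear of
the small-`d` artefacts of any circuit-size convention) ⟹ an explicit (`FP`-enumerable) family of
point lists `H_s`, `|H_s| ≤ s^c + c`, hitting `vpSlice ℚ s s s`.
[cite: GuoKumarSaptharishiSolomon2019, Thm 5 (arXiv p0005.txt:L28-31; general form ‹Thm 25› p0013.txt:L4-8; cf. ECCC TR19-065r2 Thm 3.3, p.16)] -/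
def GKSS2019_thm_5 : Prop :=
  ∀ (k : ℕ) (δ : ℝ), 0 < k → 0 < δ → ∀ P : ℕ → MvPolynomial (Fin k) ℚ,
    IsExplicitFamily (k := fun _ => k) P → (∀ d, 1 ≤ d → (P d).totalDegree = d) →
    (∃ d₀ : ℕ, ∀ d, d₀ ≤ d → (d : ℝ) ^ δ ≤ (complexity (P d) : ℝ)) →
    ∃ H : ℕ → List (List ℚ), IsExplicitPoints H ∧ (∃ c : ℕ, ∀ s, (H s).length ≤ s ^ c + c) ∧
      ∀ s, ListHits (H s) (vpSlice ℚ s s s)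

-- FACT
/-- **GKSS ‹Bootstrapping hitting sets› (journal text, unnumbered restatable after ‹Thm 5›; = ECCC
TR19-065 rev. 2 Thm 1.7, there with "`k ∈ ℕ` a large enough constant" and size `s^{O((k/δ)²)}`).**
"Assume that the underlying field `F` has characteristic zero. Let `k ∈ ℕ` and `δ > 0` be arbitrary
constants. Suppose that, for all large enough `s`, there is an explicit hitting set of size
`(s+1)^k − 1` for the class `𝒞(k, i-deg: s, s^δ)`. Then, there is an explicit hitting set of size
`poly_{δ,k}(s)` for `𝒞(s, s, s)`." Typed over `ℚ`: an explicit family `{H_s}` with, for all large `s`,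
`|H_s| ≤ (s+1)^k − 1` points of `ℚ^k` hitting `idegSlice ℚ k s (s^δ)` ⟹ an explicit `poly(s)`-size
family hitting `vpSlice ℚ s s s`.
[cite: GuoKumarSaptharishiSolomon2019, Thm ‹Bootstrapping hitting sets› (arXiv p0005.txt:L44–p0006.txt:L2; = ECCC TR19-065r2 Thm 1.7, p.6)] -/
def GKSS2019_bootstrapping : Prop :=
  ∀ (k : ℕ) (δ : ℝ), 0 < k → 0 < δ →
    (∃ H₀ : ℕ → List (List ℚ), IsExplicitPoints H₀ ∧ ∃ s₀ : ℕ, ∀ s, s₀ ≤ s →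
      (H₀ s).length ≤ (s + 1) ^ k - 1 ∧ ListHits (H₀ s) (idegSlice ℚ k s ((s : ℝ) ^ δ))) →
    ∃ H : ℕ → List (List ℚ), IsExplicitPoints H ∧ (∃ c : ℕ, ∀ s, (H s).length ≤ s ^ c + c) ∧
      ∀ s, ListHits (H s) (vpSlice ℚ s s s)

-- FACT
/-- **GKSS ‹Thm 25› (general form).** "Let `δ > 0` be an arbitrary constant, and `k : ℕ → ℕ` be any
non-decreasing function with `k(d) = o(√log d)`; let `k̃(d) = k(d^{log d})`. Suppose
`{P_{k(d),d}}_{d ∈ ℕ}` is an explicit family of polynomials such that `P_{k,d}` is `k`-variate,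
`deg(P_{k,d}) = d` and `P_{k,d}` requires circuits of size at least `d^δ` (that is,
`P_{k,d} ∉ 𝒞(k, d, d^δ)`). Then, there are explicit hitting sets of size `s^{O(k̃(s)²)}` for the class
of `𝒞(s, s, s)`." Typed over `ℚ` with `log = log₂` (`Nat.log 2` inside `k̃`; the base only rescales
the `O(·)`), `k(d) = o(√(log d))` as `∀ ε > 0`, eventually `k d ≤ ε √(log d)`; hardness for all
sufficiently large `d` (footnote: "sufficiently often" families suffice); "explicit" for the output =
computable in time `O(s^{c·k̃(s)²} + c)` on input `1^s` (polynomial when `k` is bounded).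
[cite: GuoKumarSaptharishiSolomon2019, Thm 25 (arXiv p0013.txt:L4-8, footnote on "sufficiently often" L7; cf. ECCC TR19-065r2 Thm 3.3, p.16)] -/
def GKSS2019_thm_25 : Prop :=
  ∀ (δ : ℝ) (k : ℕ → ℕ), 0 < δ → Monotone k → (∀ d, 0 < k d) →
    (∀ ε : ℝ, 0 < ε → ∀ᶠ d : ℕ in atTop, (k d : ℝ) ≤ ε * Real.sqrt (Real.log d)) →
    ∀ P : (d : ℕ) → MvPolynomial (Fin (k d)) ℚ, IsExplicitFamily P →
    (∀ d, 1 ≤ d → (P d).totalDegree = d) →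
    (∃ d₀ : ℕ, ∀ d, d₀ ≤ d → (d : ℝ) ^ δ ≤ (complexity (P d) : ℝ)) →
    ∃ (c : ℕ) (H : ℕ → List (List ℚ)),
      IsPointsInTime (fun s => s ^ (c * k (s ^ Nat.log 2 s) ^ 2) + c) H ∧
      (∀ s, (H s).length ≤ s ^ (c * k (s ^ Nat.log 2 s) ^ 2) + c) ∧
      ∀ s, ListHits (H s) (vpSlice ℚ s s s)

-- OPEN QUESTION (printed as a question; neutral statement, NOT asserted; answered affirmatively for
-- constant `k` (‹Thm 5›) and for `k(d) = o(√log d)` (‹Thm 25›) in characteristic zero; open beyond)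
/-- **GKSS ‹Question 4› (= ECCC TR19-065r2 Question 1.4).** "Let `k(d) : ℕ → ℕ` be a non-decreasing
function (a slow-growing function, or constant). If there is an explicit (in the dense
representation) polynomial family `{P_d}_{d ∈ ℕ}`, where `P_d` is a `k(d)`-variate polynomial of
degree `d` such that any algebraic circuit computing it has size `d^{Ω(k)}`, then is PIT in
`DTIME(n^{poly(k(n))})`? In particular, if `k = O(1)`, does an explicit `k`-variate polynomial family
`{P_d}`, with `deg(P_d) = d`, that requires size `d^{Ω(1)}` imply that PIT is in `P`?" Typed over `ℚ`
in the BLACK-BOX form the paper's answers take (hitting sets): hardness `d^{c₀ k(d)} ≤ complexity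
(P d)` for some `c₀ > 0` and all sufficiently large `d` ⟹ point lists `H_s` computable in time
`s^{(k(s)+c)^c}` hitting `vpSlice ℚ s s s`. Status: a QUESTION; neutral `Prop`.
[cite: GuoKumarSaptharishiSolomon2019, Question 4 (arXiv p0005.txt:L1-5; = ECCC TR19-065r2 Question 1.4, p.4)] -/
def GKSS2019_question_4 : Prop :=
  ∀ (k : ℕ → ℕ), Monotone k → (∀ d, 0 < k d) → ∀ (c₀ : ℝ), 0 < c₀ →
    ∀ P : (d : ℕ) → MvPolynomial (Fin (k d)) ℚ, IsExplicitFamily P →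
    (∀ d, 1 ≤ d → (P d).totalDegree = d) →
    (∃ d₀ : ℕ, ∀ d, d₀ ≤ d → (d : ℝ) ^ (c₀ * k d) ≤ (complexity (P d) : ℝ)) →
    ∃ (c : ℕ) (H : ℕ → List (List ℚ)),
      IsPointsInTime (fun s => s ^ ((k s + c) ^ c)) H ∧ ∀ s, ListHits (H s) (vpSlice ℚ s s s)

end Derandomization

/-! ### ‹Theorem 15› (Heintz–Schnorr [HS80], Agrawal [A05]): hitting sets give hard polynomials -/

section HeintzSchnorr

open GKSS2019 HittingSets

-- FACT (classical: dimension count; DISCHARGEABLE — linear algebra: `(d'+1)^k > |H|` unknowns)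
/-- **GKSS ‹Thm 15› ([HS80], [A05a]; individual-degree version).** "Let `H(n, i-deg: d, s)` be an
explicit hitting set for the class `𝒞(n, i-deg: d, s)`. Then, for every `k ≤ n` and `d'` such that
`d' ≤ d` and `(d'+1)^k > |H(n, i-deg: d, s)|`, there is a nonzero polynomial on `k` variables and
individual degree `d'` that vanishes on the hitting set `H(n, i-deg: d, s)`, and hence cannot be
computed by a circuit of size `s`." Typed over any field (explicitness plays no role in the
statement's content and is dropped): for a finite `H ⊆ F^n` hitting `idegSlice F n d s`, `k ≤ n`,
`d' ≤ d`, `(d'+1)^k > |H|`, there is a nonzero `g` in the first `k` variables (a polynomial in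
`F[x_1..x_n]` supported on `x_i`, `i < k`), of individual degree `≤ d'`, vanishing on `H`, with
`complexity g > s`.
[cite: GuoKumarSaptharishiSolomon2019, Thm 15 (arXiv p0009.txt:L47-48; = ECCC TR19-065r2 Thm 2.3, p.10)] -/
def GKSS2019_thm_15 : Prop :=
  ∀ (F : Type) [Field F] (n d k d' : ℕ) (s : ℝ) (H : Finset (Fin n → F)),
    IsHittingSetFor (↑H) (idegSlice F n d s) → k ≤ n → d' ≤ d → H.card < (d' + 1) ^ k →
    ∃ g : MvPolynomial (Fin n) F, g ≠ 0 ∧ (∀ i, degreeOf i g ≤ d') ∧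
      (∀ i : Fin n, k ≤ i.val → degreeOf i g = 0) ∧ (∀ a ∈ H, eval a g = 0) ∧
      s < (complexity g : ℝ)

end HeintzSchnorr

end Literature.Computability.AlgebraicComplexity

end
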